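import Literature.AnabelianGeometry.AbsoluteAnabelian.MLFClosureUnitsAnchorProofs
import HarnessLib

/-!
# [AbsTopIII] Prop 3.2 (iv), surjectivity for `T = TM`, REDUCED to the `TLG` lifting statement

Proof-only companion (theorems only, no new definitions) of `MonoidKummerMaps.lean` (seat
abc-iut-L4-t2; S. Mochizuki, *Topics in Absolute Anabelian Geometry III*, Prop. 3.2 (iv) p. 72 and
Prop. 3.3 (ii) p. 74, kurims manuscript, lit key `paper:url-5493eb38cbb7`; author's Comments (2019)
item (5) for the corrected hypotheses).

MAIN THEOREM (`ModelMLFGaloisData.exists_tmPair_iso_of_tlgPair_iso`): every isomorphism of the model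
`TLG`-pairs `(Π_{k₁} ↷ k̄₁^×) ⥲ (Π_{k₂} ↷ k̄₂^×)` has the same Galois component as an isomorphism of the
model `TM`-pairs `(Π_{k₁} ↷ 𝒪_{k̄₁}^⊳) ⥲ (Π_{k₂} ↷ 𝒪_{k̄₂}^⊳)`.  PROOF: let `β : k̄₁^× ⥲ k̄₂^×` be the
multiplicative, Galois-compatible bijection.  (1) UNITS: by Remark 3.1.1 in Galois-theoretic form
(`MLFClosureUnitsAnchorProofs.lean`) `x ∈ 𝒪^×` iff for some prime `ℓ` and all `n`, `x` has an `ℓⁿ`-th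
root fixed by every Galois element fixing `x` — a property `β` transports; so
`β(𝒪_{k̄₁}^×) = 𝒪_{k̄₂}^×` (`ModelMLFGaloisData.coe_map_mem_unitSubmonoid`).  (2) SIGN: for an integral
non-unit `x` and the anchor `ϖ` one has `x^m = ϖⁿ·u` with `m ≥ 1`, `u` a unit; hence if `β(ϖ)` is
integral then so is `β(x)^m`, whence `β(x)`, while if `β(ϖ)⁻¹` is integral the same holds for
`x ↦ β(x)⁻¹` (`ModelMLFGaloisData.forall_coe_map_mem_nonzeroIntegers_or`).  (3) Replacing `β` by
`β ∘ (·)⁻¹` if necessary, `β` maps `𝒪^⊳` into `𝒪^⊳`, and then so does `β⁻¹` (else `β⁻¹ ∘ (·)⁻¹` would,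
forcing `ϖ₂⁻¹ ∈ 𝒪^⊳`; `ModelMLFGaloisData.forall_coe_symm_mem_nonzeroIntegers`); the restriction is the
required `TM`-isomorphism.

CONSEQUENCES for the named facts of `MonoidKummerMaps.lean` (in the corrected schema form
`GaloisIsoLiftsToTMPairIso (H : GaloisMonoidPair → Prop)`, revision p410207):
* `galoisIsoLiftsToTMPairIso_of_tlgLifting` — for EVERY `H`, `GaloisIsoLiftsToTMPairIso H` FOLLOWS from
  the `TLG` lifting sentence "every `𝒯𝒢`-isomorphism `Π ⥲ Π*` of MLF-Galois `TLG`-pairs respecting the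
  arithmetic quotients lifts to an isomorphism of pairs" (`tmPairIso_lifts_of_tlgLifting` is the
  hypothesis-free `TM` statement itself);
* `galoisIsoLiftsToTMPairIso_of_unitPairIsoFibres` — in particular from `UnitPairIsoFibres`;
* `galoisIsoLiftsToTMPairIso_of_tlgLifting_relative` / `…_of_unitPairIsoFibresOfType` — the same
  relative to hypothesis predicates `HM`/`HL` on `TM`- and `TLG`-pairs (e.g. the `TLG` clause of
  `UnitPairIsoFibresOfType HL`), given that `HL` passes to the `TLG`-pair of the model data of a
  `TM`-pair satisfying `HM`.
With `MonoidKummerMapsUnitPairProofs.lean` / `MLFGaloisUnitsRigidityProofs.lean` /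
`MonoidKummerMapsUnitFibresProofs.lean` (abc-iut-L6-t21) and `MonoidKummerMapsProofs.lean`
(abc-iut-L6-t13), the local-class-field-theory content of the file's surjectivity sentences is thereby
concentrated in the ONE `TLG` lifting sentence ([AbsAnab] Prop. 1.2.1; not proved here).

HONEST FRAMING: OUR kernel check of a reduction between statements of a refereed paper; nothing here
bears on [IUTchIII] Cor. 3.12.
-/

noncomputable section

open scoped Classical

namespace Literature.AnabelianGeometry.AbsoluteAnabelian

open _root_.ValuativeRel IntermediateField
open Literature.NumberTheory.GaloisRepresentations

universe u

/-! ### §2. Two algebraic closures and a Galois-compatible multiplicative bijection `k̄₁^× ⥲ k̄₂^×` -/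

section TwoClosures

variable {C₁ C₂ : MLFClosure.{u}} {D₁ : ModelMLFGaloisData C₁.k C₁.K} {D₂ : ModelMLFGaloisData C₂.k C₂.K}
  (φ : D₁.Pi ≃ D₂.Pi) (β : ↥(nonZeroDivisors C₁.K) ≃* ↥(nonZeroDivisors C₂.K))
  (hβ : ∀ (g : D₁.Pi) (x : ↥(nonZeroDivisors C₁.K)), (β (g • x) : C₂.K) = D₂.aug (φ g) (β x : C₂.K))

include hβ

/-- The inverse bijection is Galois-compatible along `φ⁻¹`. [cite: MochizukiAbsTopIII2015, Definition 3.1 (ii) p.67] -/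
theorem ModelMLFGaloisData.symm_equivariant (g : D₂.Pi) (z : ↥(nonZeroDivisors C₂.K)) :
    (β.symm (g • z) : C₁.K) = D₁.aug (φ.symm g) (β.symm z : C₁.K) := by
  have h1 : β (φ.symm g • β.symm z) = g • z := by
    apply Subtype.ext
    rw [hβ, Equiv.apply_symm_apply, MulEquiv.apply_symm_apply]
    rfl
  rw [← h1, MulEquiv.symm_apply_apply]
  rfl

/-- **Units go to units** (Remark 3.1.1 is Galois-theoretic): a Galois-compatible multiplicative
bijection `k̄₁^× ⥲ k̄₂^×` maps `𝒪_{k̄₁}^×` into `𝒪_{k̄₂}^×`. [cite: MochizukiAbsTopIII2015, Remark 3.1.1 p.70] -/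
theorem ModelMLFGaloisData.coe_map_mem_unitSubmonoid (x : ↥(nonZeroDivisors C₁.K))
    (hx : (x : C₁.K) ∈ unitSubmonoid C₁.k C₁.K) : (β x : C₂.K) ∈ unitSubmonoid C₂.k C₂.K := by
  have hx0 : (x : C₁.K) ≠ 0 := nonZeroDivisors.coe_ne_zero x
  have hβx0 : (β x : C₂.K) ≠ 0 := nonZeroDivisors.coe_ne_zero (β x)
  rw [C₁.mem_unitSubmonoid_iff_exists_prime_forall_exists_fixed_pow_eq hx0] at hx
  obtain ⟨ℓ, hℓ, hroots⟩ := hx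
  rw [C₂.mem_unitSubmonoid_iff_exists_prime_forall_exists_fixed_pow_eq hβx0]
  refine ⟨ℓ, hℓ, fun n => ?_⟩
  obtain ⟨y, hyfix, hyx⟩ := hroots n
  have hy0 : y ≠ 0 := by
    rintro rfl
    rw [zero_pow (pow_ne_zero _ hℓ.ne_zero)] at hyx
    exact hx0 hyx.symm
  set y' : ↥(nonZeroDivisors C₁.K) := ⟨y, mem_nonZeroDivisors_of_ne_zero hy0⟩ with hy'
  have hy'x : y' ^ (ℓ ^ n) = x := Subtype.ext (by rw [SubmonoidClass.coe_pow]; exact hyx)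
  refine ⟨(β y' : C₂.K), fun τ hτ => ?_, by rw [← SubmonoidClass.coe_pow, ← map_pow, hy'x]⟩
  obtain ⟨g₂, rfl⟩ := D₂.aug_surjective τ
  obtain ⟨g₁, rfl⟩ := φ.surjective g₂
  -- `g₁` fixes `x`, hence `y`
  have h1 : β (g₁ • x) = β x := Subtype.ext (by rw [hβ]; exact hτ)
  have h2 : g₁ • x = x := β.injective h1
  have h3 : D₁.aug g₁ (x : C₁.K) = x := congrArg Subtype.val h2
  have h4 : D₁.aug g₁ y = y := hyfix _ h3
  have h5 : g₁ • y' = y' := Subtype.ext h4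
  rw [← hβ, h5]

omit hβ in
/-- `β(x⁻¹) = β(x)⁻¹` on underlying elements. [folklore] -/
private theorem coe_map_inv_aux (x y : ↥(nonZeroDivisors C₁.K)) (hxy : (x : C₁.K) * y = 1) :
    (β y : C₂.K) = (β x : C₂.K)⁻¹ := by
  have h : x * y = 1 := Subtype.ext (by rw [Submonoid.coe_mul]; exact hxy)
  have h2 : (β x : C₂.K) * (β y : C₂.K) = 1 := by
    rw [← Submonoid.coe_mul, ← map_mul, h, map_one, Submonoid.coe_one]
  exact (eq_inv_of_mul_eq_one_right h2)

/-- **The sign dichotomy**: a Galois-compatible multiplicative bijection `β : k̄₁^× ⥲ k̄₂^×` maps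
`𝒪_{k̄₁}^⊳` into `𝒪_{k̄₂}^⊳`, or `x ↦ β(x)⁻¹` does (according as `β` of a uniformizer is integral or
co-integral). [cite: MochizukiAbsTopIII2015, Proposition 3.2 (iv) p.72] -/
theorem ModelMLFGaloisData.forall_coe_map_mem_nonzeroIntegers_or :
    (∀ x : ↥(nonZeroDivisors C₁.K), (x : C₁.K) ∈ nonzeroIntegers C₁.k C₁.K →
        (β x : C₂.K) ∈ nonzeroIntegers C₂.k C₂.K) ∨
      (∀ x : ↥(nonZeroDivisors C₁.K), (x : C₁.K) ∈ nonzeroIntegers C₁.k C₁.K →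
        (β x : C₂.K)⁻¹ ∈ nonzeroIntegers C₂.k C₂.K) := by
  obtain ⟨ϖ, hϖint, -, hanchor⟩ := C₁.exists_anchor
  set w : ↥(nonZeroDivisors C₁.K) := ⟨ϖ, mem_nonZeroDivisors_of_ne_zero hϖint.2⟩ with hw
  -- the Kummer-free part: the identity `β(x)^m = β(ϖ)^n · β(u)`
  have hrel : ∀ x : ↥(nonZeroDivisors C₁.K), (x : C₁.K) ∈ nonzeroIntegers C₁.k C₁.K →
      (x : C₁.K) ∉ unitSubmonoid C₁.k C₁.K →
      ∃ m n : ℕ, 0 < m ∧ ∃ u : ↥(nonZeroDivisors C₁.K), (β u : C₂.K) ∈ unitSubmonoid C₂.k C₂.K ∧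
        (β x : C₂.K) ^ m = (β w : C₂.K) ^ n * (β u : C₂.K) := by
    intro x hx hxu
    obtain ⟨m, n, hm, u, hu, hxmn⟩ := hanchor x hx hxu
    have hu0 : u ≠ 0 := ((mem_unitSubmonoid_iff C₁.k C₁.K).mp hu).1
    set u' : ↥(nonZeroDivisors C₁.K) := ⟨u, mem_nonZeroDivisors_of_ne_zero hu0⟩ with hu'
    refine ⟨m, n, hm, u', ModelMLFGaloisData.coe_map_mem_unitSubmonoid φ β hβ u' hu, ?_⟩
    have hid : x ^ m = w ^ n * u' :=
      Subtype.ext (by rw [SubmonoidClass.coe_pow, Submonoid.coe_mul, SubmonoidClass.coe_pow]; exact hxmn)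
    rw [← SubmonoidClass.coe_pow, ← map_pow, hid, map_mul, map_pow, Submonoid.coe_mul, SubmonoidClass.coe_pow]
  rcases C₂.mem_nonzeroIntegers_or_inv_mem (nonZeroDivisors.coe_ne_zero (β w)) with hA | hB
  · left
    intro x hx
    by_cases hxu : (x : C₁.K) ∈ unitSubmonoid C₁.k C₁.K
    · exact unitSubmonoid_le_nonzeroIntegers
        (ModelMLFGaloisData.coe_map_mem_unitSubmonoid φ β hβ x hxu)
    obtain ⟨m, n, hm, u, hu, hrel'⟩ := hrel x hx hxu
    exact C₂.mem_nonzeroIntegers_of_pow_eq hm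
      (Submonoid.mul_mem _ (Submonoid.pow_mem _ hA n) (unitSubmonoid_le_nonzeroIntegers hu)) hrel'
  · right
    intro x hx
    by_cases hxu : (x : C₁.K) ∈ unitSubmonoid C₁.k C₁.K
    · exact unitSubmonoid_le_nonzeroIntegers
        (C₂.inv_mem_unitSubmonoid (ModelMLFGaloisData.coe_map_mem_unitSubmonoid φ β hβ x hxu))
    obtain ⟨m, n, hm, u, hu, hrel'⟩ := hrel x hx hxu
    have hrel'' : ((β x : C₂.K)⁻¹) ^ m = ((β w : C₂.K)⁻¹) ^ n * (β u : C₂.K)⁻¹ := by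
      rw [inv_pow, inv_pow, ← mul_inv, hrel']
    exact C₂.mem_nonzeroIntegers_of_pow_eq hm (Submonoid.mul_mem _ (Submonoid.pow_mem _ hB n)
      (unitSubmonoid_le_nonzeroIntegers (C₂.inv_mem_unitSubmonoid hu))) hrel''

/-- **Consistency of the sign**: if `β` maps `𝒪_{k̄₁}^⊳` into `𝒪_{k̄₂}^⊳`, then `β⁻¹` maps `𝒪_{k̄₂}^⊳`
into `𝒪_{k̄₁}^⊳` (else `ϖ₂⁻¹` would be integral). [cite: MochizukiAbsTopIII2015, Proposition 3.2 (iv) p.72] -/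
theorem ModelMLFGaloisData.forall_coe_symm_mem_nonzeroIntegers
    (hA : ∀ x : ↥(nonZeroDivisors C₁.K), (x : C₁.K) ∈ nonzeroIntegers C₁.k C₁.K →
      (β x : C₂.K) ∈ nonzeroIntegers C₂.k C₂.K) :
    ∀ z : ↥(nonZeroDivisors C₂.K), (z : C₂.K) ∈ nonzeroIntegers C₂.k C₂.K →
      (β.symm z : C₁.K) ∈ nonzeroIntegers C₁.k C₁.K := by
  have hβ' := ModelMLFGaloisData.symm_equivariant φ β hβ
  rcases ModelMLFGaloisData.forall_coe_map_mem_nonzeroIntegers_or φ.symm β.symm hβ' with h | h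
  · exact h
  · exfalso
    obtain ⟨ϖ₂, hϖint, hϖinv, -⟩ := C₂.exists_anchor
    set w : ↥(nonZeroDivisors C₂.K) := ⟨ϖ₂, mem_nonZeroDivisors_of_ne_zero hϖint.2⟩ with hw
    have h1 : (β.symm w : C₁.K)⁻¹ ∈ nonzeroIntegers C₁.k C₁.K := h w hϖint
    set t : ↥(nonZeroDivisors C₁.K) :=
      ⟨(β.symm w : C₁.K)⁻¹, mem_nonZeroDivisors_of_ne_zero h1.2⟩ with ht
    have h2 : (β t : C₂.K) ∈ nonzeroIntegers C₂.k C₂.K := hA t h1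
    have h3 : (β t : C₂.K) = (β (β.symm w) : C₂.K)⁻¹ :=
      coe_map_inv_aux β (β.symm w) t (mul_inv_cancel₀ (nonZeroDivisors.coe_ne_zero _))
    rw [h3, MulEquiv.apply_symm_apply] at h2
    exact hϖinv h2

end TwoClosures

/-! ### §3. `TLG`-isomorphisms of model pairs restrict (up to the sign) to `TM`-isomorphisms -/

section ModelLift

variable {C₁ C₂ : MLFClosure.{u}} (D₁ : ModelMLFGaloisData C₁.k C₁.K) (D₂ : ModelMLFGaloisData C₂.k C₂.K)

/-- Restriction step: a Galois-compatible (along `f`) multiplicative bijection `k̄₁^× ⥲ k̄₂^×` mapping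
`𝒪^⊳` into `𝒪^⊳` restricts to an isomorphism of the model `TM`-pairs over `f`.
[cite: MochizukiAbsTopIII2015, Proposition 3.2 (iv) p.72] -/
theorem ModelMLFGaloisData.exists_tmPair_iso_of_forall_mem_nonzeroIntegers (f : D₁.Pi ≃ₜ* D₂.Pi)
    (β : ↥(nonZeroDivisors C₁.K) ≃* ↥(nonZeroDivisors C₂.K))
    (hβ : ∀ (g : D₁.Pi) (x : ↥(nonZeroDivisors C₁.K)), (β (g • x) : C₂.K) = D₂.aug (f g) (β x : C₂.K))
    (hA : ∀ x : ↥(nonZeroDivisors C₁.K), (x : C₁.K) ∈ nonzeroIntegers C₁.k C₁.K →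
      (β x : C₂.K) ∈ nonzeroIntegers C₂.k C₂.K) :
    ∃ e : GaloisMonoidPair.Iso D₁.tmPair D₂.tmPair, e.isoPi = f := by
  have hβ' : ∀ (g : D₁.Pi) (x : ↥(nonZeroDivisors C₁.K)),
      (β (g • x) : C₂.K) = D₂.aug (f.toMulEquiv.toEquiv g) (β x : C₂.K) := hβ
  have hA' := ModelMLFGaloisData.forall_coe_symm_mem_nonzeroIntegers f.toMulEquiv.toEquiv β hβ' hA
  -- the two inclusions `𝒪^⊳ ↪ k̄^×`
  have i₁ : ∀ x : ↥(nonzeroIntegers C₁.k C₁.K), (x : C₁.K) ∈ nonZeroDivisors C₁.K := fun x =>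
    mem_nonZeroDivisors_of_ne_zero x.2.2
  have i₂ : ∀ z : ↥(nonzeroIntegers C₂.k C₂.K), (z : C₂.K) ∈ nonZeroDivisors C₂.K := fun z =>
    mem_nonZeroDivisors_of_ne_zero z.2.2
  let γ : ↥(nonzeroIntegers C₁.k C₁.K) ≃* ↥(nonzeroIntegers C₂.k C₂.K) :=
    { toFun := fun x => ⟨(β ⟨x, i₁ x⟩ : C₂.K), hA _ x.2⟩
      invFun := fun z => ⟨(β.symm ⟨z, i₂ z⟩ : C₁.K), hA' _ z.2⟩
      left_inv := fun x => Subtype.ext (by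
        show (β.symm ⟨(β ⟨x, i₁ x⟩ : C₂.K), _⟩ : C₁.K) = x
        rw [Subtype.coe_eta, MulEquiv.symm_apply_apply])
      right_inv := fun z => Subtype.ext (by
        show (β ⟨(β.symm ⟨z, i₂ z⟩ : C₁.K), _⟩ : C₂.K) = z
        rw [Subtype.coe_eta, MulEquiv.apply_symm_apply])
      map_mul' := fun x y => Subtype.ext (by
        have h : (⟨((x * y : ↥(nonzeroIntegers C₁.k C₁.K)) : C₁.K), i₁ (x * y)⟩ :
            ↥(nonZeroDivisors C₁.K)) = ⟨x, i₁ x⟩ * ⟨y, i₁ y⟩ := Subtype.ext rfl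
        show (β ⟨((x * y : ↥(nonzeroIntegers C₁.k C₁.K)) : C₁.K), i₁ (x * y)⟩ : C₂.K) =
          (β ⟨x, i₁ x⟩ : C₂.K) * (β ⟨y, i₁ y⟩ : C₂.K)
        rw [h, map_mul, Submonoid.coe_mul]) }
  refine ⟨⟨f, γ, fun g x => Subtype.ext ?_⟩, rfl⟩
  show (β ⟨D₁.aug g • (x : C₁.K), _⟩ : C₂.K) = D₂.aug (f g) • (β ⟨x, i₁ x⟩ : C₂.K)
  have h1 : (⟨D₁.aug g • (x : C₁.K), i₁ (g • x)⟩ : ↥(nonZeroDivisors C₁.K)) = g • ⟨x, i₁ x⟩ :=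
    Subtype.ext rfl
  rw [h1, hβ]
  rfl

/-- **MAIN THEOREM (model form).**  Every isomorphism of the model `TLG`-pairs
`(Π_{k₁} ↷ k̄₁^×) ⥲ (Π_{k₂} ↷ k̄₂^×)` has the Galois component of an isomorphism of the model `TM`-pairs
`(Π_{k₁} ↷ 𝒪_{k̄₁}^⊳) ⥲ (Π_{k₂} ↷ 𝒪_{k̄₂}^⊳)`: its `k̄^×`-component, or that composed with the inversion,
maps `𝒪^⊳` onto `𝒪^⊳`. [cite: MochizukiAbsTopIII2015, Proposition 3.2 (iv) p.72] -/
theorem ModelMLFGaloisData.exists_tmPair_iso_of_tlgPair_iso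
    (e' : GaloisMonoidPair.Iso D₁.tlgPair D₂.tlgPair) :
    ∃ e : GaloisMonoidPair.Iso D₁.tmPair D₂.tmPair, e.isoPi = e'.isoPi := by
  have hβ : ∀ (g : D₁.Pi) (x : ↥(nonZeroDivisors C₁.K)),
      (e'.isoM (g • x) : C₂.K) = D₂.aug (e'.isoPi g) (e'.isoM x : C₂.K) := fun g x =>
    congrArg Subtype.val (e'.smul_comm g x)
  have hβe : ∀ (g : D₁.Pi) (x : ↥(nonZeroDivisors C₁.K)),
      (e'.isoM (g • x) : C₂.K) = D₂.aug (e'.isoPi.toMulEquiv.toEquiv g) (e'.isoM x : C₂.K) := hβ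
  rcases ModelMLFGaloisData.forall_coe_map_mem_nonzeroIntegers_or e'.isoPi.toMulEquiv.toEquiv
    e'.isoM hβe with hA | hB
  · exact ModelMLFGaloisData.exists_tmPair_iso_of_forall_mem_nonzeroIntegers D₁ D₂ e'.isoPi e'.isoM
      hβ hA
  · -- twist by the inversion of `k̄₂^×`
    let ι : ↥(nonZeroDivisors C₂.K) ≃* ↥(nonZeroDivisors C₂.K) :=
      { toFun := fun z => ⟨(z : C₂.K)⁻¹, mem_nonZeroDivisors_of_ne_zero
          (inv_ne_zero (nonZeroDivisors.coe_ne_zero z))⟩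
        invFun := fun z => ⟨(z : C₂.K)⁻¹, mem_nonZeroDivisors_of_ne_zero
          (inv_ne_zero (nonZeroDivisors.coe_ne_zero z))⟩
        left_inv := fun z => Subtype.ext (by simp)
        right_inv := fun z => Subtype.ext (by simp)
        map_mul' := fun z w => Subtype.ext (by
          show ((z : C₂.K) * w)⁻¹ = (z : C₂.K)⁻¹ * (w : C₂.K)⁻¹
          rw [mul_inv]) }
    have hι : ∀ z, (ι z : C₂.K) = (z : C₂.K)⁻¹ := fun z => rfl
    have hβ₁ : ∀ (g : D₁.Pi) (x : ↥(nonZeroDivisors C₁.K)),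
        ((e'.isoM.trans ι) (g • x) : C₂.K) = D₂.aug (e'.isoPi g) ((e'.isoM.trans ι) x : C₂.K) := by
      intro g x
      rw [MulEquiv.trans_apply, MulEquiv.trans_apply, hι, hι, hβ, map_inv₀]
    have hA₁ : ∀ x : ↥(nonZeroDivisors C₁.K), (x : C₁.K) ∈ nonzeroIntegers C₁.k C₁.K →
        ((e'.isoM.trans ι) x : C₂.K) ∈ nonzeroIntegers C₂.k C₂.K := by
      intro x hx
      rw [MulEquiv.trans_apply, hι]
      exact hB x hx
    exact ModelMLFGaloisData.exists_tmPair_iso_of_forall_mem_nonzeroIntegers D₁ D₂ e'.isoPi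
      (e'.isoM.trans ι) hβ₁ hA₁

end ModelLift

/-! ### §4. The named facts -/

/-- **[AbsTopIII] Prop 3.2 (iv), surjectivity for `T = TM`, FROM the `TLG` lifting statement —
relative form.**  Let `HM`, `HL` be hypothesis predicates on pairs ("of hyperbolic orbicurve type" for
`TM`- resp. `TLG`-pairs) such that `HL` holds for the model `TLG`-pair `(Π ↷ k̄^×)` of any model data
whose `TM`-pair `(Π ↷ 𝒪_k̄^⊳)` is isomorphic to a pair satisfying `HM`.  If every `𝒯𝒢`-isomorphism
`Π ⥲ Π*` of MLF-Galois `TLG`-pairs satisfying `HL` that respects the arithmetic quotients lifts to an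
isomorphism of pairs, then the named fact `GaloisIsoLiftsToTMPairIso HM` holds.
[cite: MochizukiAbsTopIII2015, Proposition 3.2 (iv) p.72] -/
theorem galoisIsoLiftsToTMPairIso_of_tlgLifting_relative (HM HL : GaloisMonoidPair.{0} → Prop)
    (hcompat : ∀ (C : MLFClosure.{0}) (D : ModelMLFGaloisData C.k C.K) (P : GaloisMonoidPair.{0}),
      Nonempty (GaloisMonoidPair.Iso D.tmPair P) → HM P → HL D.tlgPair)
    (hlift : ∀ (P Q : GaloisMonoidPair.{0}), IsMLFGaloisMonoidPair .TLG P →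
      IsMLFGaloisMonoidPair .TLG Q → HL P → HL Q → ∀ f : P.Pi ≃ₜ* Q.Pi,
        P.actionKer.map f.toMulEquiv.toMonoidHom = Q.actionKer →
          ∃ e : GaloisMonoidPair.Iso P Q, e.isoPi = f) :
    GaloisIsoLiftsToTMPairIso HM := by
  intro P Q hP hQ hHP hHQ f hf
  obtain ⟨C₁, D₁, P₁, hP₁, ⟨ι₁⟩⟩ := hP.exists_model
  obtain ⟨C₂, D₂, Q₂, hQ₂, ⟨ι₂⟩⟩ := hQ.exists_model
  rw [ModelMLFGaloisData.monoidPair_TM, Option.some.injEq] at hP₁ hQ₂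
  subst hP₁
  subst hQ₂
  -- the Galois isomorphism between the model groups, and its compatibility with the quotients
  have hf'k : D₁.tlgPair.actionKer.map (ι₁.isoPi.trans (f.trans ι₂.isoPi.symm)).toMulEquiv.toMonoidHom =
      D₂.tlgPair.actionKer := by
    have hcomp : (ι₁.isoPi.trans (f.trans ι₂.isoPi.symm)).toMulEquiv.toMonoidHom =
        ι₂.isoPi.symm.toMulEquiv.toMonoidHom.comp
          (f.toMulEquiv.toMonoidHom.comp ι₁.isoPi.toMulEquiv.toMonoidHom) :=
      MonoidHom.ext fun _ => rfl
    rw [ModelMLFGaloisData.tlgPair_actionKer C₁ D₁, ModelMLFGaloisData.tlgPair_actionKer C₂ D₂,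
      ← ModelMLFGaloisData.tmPair_actionKer C₁ D₁, ← ModelMLFGaloisData.tmPair_actionKer C₂ D₂, hcomp,
      ← Subgroup.map_map, ← Subgroup.map_map, ι₁.map_actionKer, hf, ι₂.symm_map_actionKer]
  obtain ⟨e₀, he₀⟩ := hlift D₁.tlgPair D₂.tlgPair (isMLFGaloisMonoidPair_tlgPair C₁ D₁)
    (isMLFGaloisMonoidPair_tlgPair C₂ D₂) (hcompat C₁ D₁ P ⟨ι₁⟩ hHP) (hcompat C₂ D₂ Q ⟨ι₂⟩ hHQ)
    (ι₁.isoPi.trans (f.trans ι₂.isoPi.symm)) hf'k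
  obtain ⟨e₁, he₁⟩ := ModelMLFGaloisData.exists_tmPair_iso_of_tlgPair_iso D₁ D₂ e₀
  rw [he₀] at he₁
  refine ⟨⟨f, ι₁.isoM.symm.trans (e₁.isoM.trans ι₂.isoM), fun g x => ?_⟩, rfl⟩
  show ι₂.isoM (e₁.isoM (ι₁.isoM.symm (g • x))) = f g • ι₂.isoM (e₁.isoM (ι₁.isoM.symm x))
  rw [GaloisMonoidPair.Iso.symm_smul_comm, e₁.smul_comm, ι₂.smul_comm, he₁]
  show ι₂.isoPi (ι₂.isoPi.symm (f (ι₁.isoPi (ι₁.isoPi.symm g)))) • _ = _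
  rw [ContinuousMulEquiv.apply_symm_apply, ContinuousMulEquiv.apply_symm_apply]

/-- **[AbsTopIII] Prop 3.2 (iv), surjectivity for `T = TM`, FROM the (hypothesis-free) `TLG` lifting
statement**: if every `𝒯𝒢`-isomorphism `Π ⥲ Π*` of MLF-Galois `TLG`-pairs respecting the arithmetic
quotients lifts to an isomorphism of pairs, then `GaloisIsoLiftsToTMPairIso H` holds for EVERY
hypothesis predicate `H` (in particular in the author's corrected form, Comments (2019) item (5)).
[cite: MochizukiAbsTopIII2015, Proposition 3.2 (iv) p.72] -/
theorem galoisIsoLiftsToTMPairIso_of_tlgLifting (H : GaloisMonoidPair.{0} → Prop)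
    (hlift : ∀ (P Q : GaloisMonoidPair.{0}), IsMLFGaloisMonoidPair .TLG P →
      IsMLFGaloisMonoidPair .TLG Q → ∀ f : P.Pi ≃ₜ* Q.Pi,
        P.actionKer.map f.toMulEquiv.toMonoidHom = Q.actionKer →
          ∃ e : GaloisMonoidPair.Iso P Q, e.isoPi = f) :
    GaloisIsoLiftsToTMPairIso H :=
  galoisIsoLiftsToTMPairIso_of_tlgLifting_relative H (fun _ => True) (fun _ _ _ _ _ => trivial)
    fun P Q hP hQ _ _ f hf => hlift P Q hP hQ f hf

/-- The hypothesis-free `TM` lifting statement itself (the pre-erratum reading of Prop. 3.2 (iv) with the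
quotient-compatibility binder) FOLLOWS from the `TLG` lifting statement.
[cite: MochizukiAbsTopIII2015, Proposition 3.2 (iv) p.72] -/
theorem tmPairIso_lifts_of_tlgLifting
    (hlift : ∀ (P Q : GaloisMonoidPair.{0}), IsMLFGaloisMonoidPair .TLG P →
      IsMLFGaloisMonoidPair .TLG Q → ∀ f : P.Pi ≃ₜ* Q.Pi,
        P.actionKer.map f.toMulEquiv.toMonoidHom = Q.actionKer →
          ∃ e : GaloisMonoidPair.Iso P Q, e.isoPi = f)
    (P Q : GaloisMonoidPair.{0}) (hP : IsMLFGaloisMonoidPair .TM P) (hQ : IsMLFGaloisMonoidPair .TM Q)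
    (f : P.Pi ≃ₜ* Q.Pi) (hf : P.actionKer.map f.toMulEquiv.toMonoidHom = Q.actionKer) :
    ∃ e : GaloisMonoidPair.Iso P Q, e.isoPi = f :=
  galoisIsoLiftsToTMPairIso_of_tlgLifting (fun _ => True) hlift P Q hP hQ trivial trivial f hf

/-- **[AbsTopIII] Prop 3.2 (iv) surjectivity (`TM`) FROM Prop 3.3 (ii) (`TLG`)**: the named fact
`UnitPairIsoFibres` implies the named fact `GaloisIsoLiftsToTMPairIso H` for every `H`.
[cite: MochizukiAbsTopIII2015, Proposition 3.2 (iv) p.72] -/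
theorem galoisIsoLiftsToTMPairIso_of_unitPairIsoFibres (H : GaloisMonoidPair.{0} → Prop)
    (h : UnitPairIsoFibres) : GaloisIsoLiftsToTMPairIso H :=
  galoisIsoLiftsToTMPairIso_of_tlgLifting H fun P Q hP hQ f hf => by
    obtain ⟨e₁, -, he₁, -⟩ := h.2 P Q hP hQ f hf
    exact ⟨e₁, he₁⟩

/-- **Corrected forms, relative version**: the `TLG` clause of `UnitPairIsoFibresOfType HL` (Prop. 3.3
(ii) as corrected, Comments (2019) item (5)) implies `GaloisIsoLiftsToTMPairIso HM` as soon as the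
hypothesis predicate passes from a `TM`-pair to the `TLG`-pair of its model data.
[cite: MochizukiAbsTopIII2015, Proposition 3.2 (iv) p.72]
[cite: MochizukiAbsTopIIIComments2019, item (5)] -/
theorem galoisIsoLiftsToTMPairIso_of_unitPairIsoFibresOfType (HM HL : GaloisMonoidPair.{0} → Prop)
    (hcompat : ∀ (C : MLFClosure.{0}) (D : ModelMLFGaloisData C.k C.K) (P : GaloisMonoidPair.{0}),
      Nonempty (GaloisMonoidPair.Iso D.tmPair P) → HM P → HL D.tlgPair)
    (h : UnitPairIsoFibresOfType HL) : GaloisIsoLiftsToTMPairIso HM :=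
  galoisIsoLiftsToTMPairIso_of_tlgLifting_relative HM HL hcompat fun P Q hP hQ hHP hHQ f hf => by
    obtain ⟨e₁, -, he₁, -⟩ := h.2 P Q hP hQ hHP hHQ f hf
    exact ⟨e₁, he₁⟩

end Literature.AnabelianGeometry.AbsoluteAnabelian

end
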